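import Summits.QuantumFields.YangMills.Theorems.LuscherReductionTwistedTraceScalingBOAssemblySlow
import Summits.QuantumFields.YangMills.Theorems.LuscherReductionTwistedTraceScalingBOAssemblyFloor
import Summits.QuantumFields.YangMills.Theorems.LuscherReductionTwistedTraceScalingSoftTubeOn
import Summits.QuantumFields.YangMills.Theorems.LuscherReductionTwistedTraceScalingOneSiteInner
import Summits.QuantumFields.YangMills.Theorems.LuscherReductionTwistedTraceScalingOneSiteNearTop
import HarnessLib

/-!
# THE TYPED BRICK LIST of the Born–Oppenheimer package (`BOBricks`) and the arithmetic of the assembly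
# (lane A of S-BASE, crux `TwistedTraceScaling` stmt-QuantumFields-20203, C4 INNER; design note `pub/ym-fleet/ym-luscher-20007-p1/COARSE-DESIGN.md` §24.4 (G))

`BOBricks L χ δ` packages, for a weight family `χ` (think `recordWeightRho (3δ) ρ δg`) and a test-support radius `δ`, the Born–Oppenheimer DATA (fibre profile `Ω β`, slow window
`𝒰 β`, constants `σ γ κ b : ℝ → ℝ`, stiff gap `θ₀`, radii `δ₁ δ₂`, copy margin `m`) together with
* STRUCTURAL hypotheses (all eventually in β): `χ` measurable with `0 ≤ χ ≤ 1`, `χ ≥ c β > 0` on its support; the weight `N/χ` bounded measurable, nonnegative, colour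
  invariant; `Ω β` measurable, `|Ω| ≤ 1`, colour blind; `𝒰 β` measurable, conjugation invariant, inside `{orbitDist₁ < δ₁ β}` with `δ₁ ≤ 1/2`, containing the slow shadow of
  `supp χ ∩ {orbitDist < δ}` and the one-site core `{orbitDist₁ < 13(L³β)^{-1/5}}`; `supp χ ⊆ orthoTubeSet`; BO functions over `𝒰` live in `supp χ ∩ {orbitDist < δ₂}`,
  `L(δ₂ + m) < 2`;
* the four ANALYTIC BRICKS (eventually in β): (B-N) `|fibreMass − γ| ≤ κγ` on `𝒰`; (B-T) `|T(boFun φ̄ Ω) − σγ⟨φ̄,K_{L³β}φ̄⟩₁| ≤ κσγ(⟨φ̄,Kφ̄⟩₁ + μ₀‖φ̄‖²)` for gauge-invariant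
  one-site amplitudes `φ̄ ⊆ 𝒰` — THE OWED LAPLACE BRICK (F); (B-ST) `T(v) ≤ (1−θ₀)σμ₀‖v‖²_w` for `v ⊆ supp χ` fibrewise `w`-orthogonal to `Ω` — OWED (ST); (B-OD)
  `|X(boFun φ Ω, v)|, |X(v, boFun φ Ω)| ≤ bσμ₀‖boFun φ Ω‖_w‖v‖_w` — OWED (OD); with rates `κ = o(λ_b)`, `b² = o(λ_b)`.
This file also proves the two real-number endgames `arith_slow`, `arith_floor` (`y = ελ_b ≤ 1`, `κ ≤ y/48`).  The assembly theorem
`softTubeBOPackageOn_of_bricks : BOBricks L χ δ → SoftTubeBOPackageOn L χ {orbitDist < δ}` is the next file.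
HONEST FRAMING: the typed decomposition of C4-CORE into analytic bricks; (F)(ST)(OD) are OPEN; C4 OPEN; not infinite volume, not a gap, not Clay.
-/

set_option autoImplicit false

noncomputable section

open MeasureTheory Filter Topology Real
open scoped BigOperators
open Literature.MathematicalPhysics.QuantumFieldTheory
open Literature.MathematicalPhysics.QuantumLattice

namespace Summit.QuantumFields.YangMills.Theorems.FemtoTransferGap.TwoLattice.ConstTube

open Summit.QuantumFields.YangMills.Theorems.FemtoTransferGap
open Summit.QuantumFields.YangMills.Theorems.FemtoTransferGap.TwoLattice.Avg
open Summit.QuantumFields.YangMills.Theorems.FemtoTransferGap.TwoLattice.Stiff (LinkSpace)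

variable (L : ℕ) [NeZero L]

/-! ## §1 The brick list -/

/-- **THE BORN–OPPENHEIMER BRICK LIST** for a weight family `χ` and a test-support radius `δ` (COARSE-DESIGN §24.4).  Data + structural hypotheses + the four analytic bricks;
`softTubeBOPackageOn_of_bricks` turns it into `SoftTubeBOPackageOn L χ {orbitDist < δ}`. [cite: Luscher1983, §3] [cite: SjostrandZworski2007, §2] -/
structure BOBricks (χ : ℝ → GaugeConfig 3 L SU2 → ℝ) (δ : ℝ → ℝ) where
  /-- fibre profile -/
  Ω : ℝ → LinkSpace L → ℝ
  /-- slow window -/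
  𝒰 : ℝ → Set (GaugeConfig 3 1 SU2)
  /-- fibre energy factor, fibre mass, relative error, off-diagonal size, lower bound of `χ` on its support -/
  σ : ℝ → ℝ
  γ : ℝ → ℝ
  κ : ℝ → ℝ
  b : ℝ → ℝ
  c : ℝ → ℝ
  /-- stiff gap, one-site window radius, BO support radius, copy margin -/
  θ₀ : ℝ
  δ₁ : ℝ → ℝ
  δ₂ : ℝ → ℝ
  m : ℝ
  -- structural hypotheses
  hχm : ∀ β, Measurable (χ β)
  hχ1 : ∀ β U, |χ β U| ≤ 1
  hχ0 : ∀ β U, 0 ≤ χ β U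
  hc : ∀ β, 0 < c β ∧ ∀ U, χ β U ≠ 0 → c β ≤ χ β U
  hwm : ∀ β, Measurable (softWeight (χ β))
  hwb : ∀ β, ∃ Cw : ℝ, ∀ U, |softWeight (χ β) U| ≤ Cw
  hw0 : ∀ β U, 0 ≤ softWeight (χ β) U
  hwinv : ∀ β (g : SU2) (U : GaugeConfig 3 L SU2), softWeight (χ β) (gaugeTransform (fun _ : Site 3 L => g) U) = softWeight (χ β) U
  hΩm : ∀ β, Measurable (Ω β)
  hΩ1 : ∀ β x, |Ω β x| ≤ 1
  hΩinv : ∀ β (g : SU2) (v : LinkSpace L), Ω β (adL L g v) = Ω β v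
  h𝒰m : ∀ β, MeasurableSet (𝒰 β)
  h𝒰inv : ∀ β (g : SU2) (u : GaugeConfig 3 1 SU2), gaugeTransform (fun _ : Site 3 1 => g) u ∈ 𝒰 β ↔ u ∈ 𝒰 β
  h𝒰δ₁ : ∀ β, ∀ u ∈ 𝒰 β, orbitDist u < δ₁ β
  hδ₁ : ∀ᶠ β in atTop, δ₁ β ≤ 1 / 2
  hcore : ∀ᶠ β in atTop, ∀ u : GaugeConfig 3 1 SU2, orbitDist u < 13 * ((L : ℝ) ^ 3 * β) ^ (-(1 / 5 : ℝ)) → u ∈ 𝒰 β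
  htube : ∀ᶠ β in atTop, ∀ U, χ β U ≠ 0 → U ∈ orthoTubeSet L
  hshadow : ∀ᶠ β in atTop, ∀ U, χ β U ≠ 0 → orbitDist U < δ β → slowMean L U ∈ 𝒰 β
  hbo : ∀ᶠ β in atTop, ∀ (φ : GaugeConfig 3 1 SU2 → ℝ) (U : GaugeConfig 3 L SU2), (∀ u, φ u ≠ 0 → u ∈ 𝒰 β) → boFun L φ (Ω β) U ≠ 0 → χ β U ≠ 0 ∧ orbitDist U < δ₂ β
  hm : 0 ≤ m
  hm0 : 0 < m
  hδ₂ : ∀ᶠ β in atTop, (L : ℝ) * (δ₂ β + m) < 2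
  hσ : ∀ β, 0 < σ β
  hγ : ∀ β, 0 < γ β
  hκ : ∀ β, 0 ≤ κ β
  hb : ∀ β, 0 ≤ b β
  hθ₀ : 0 < θ₀ ∧ θ₀ ≤ 1
  hκ_small : ∀ a : ℝ, 0 < a → ∀ᶠ β in atTop, κ β ≤ a * bareLambda ((L : ℝ) ^ 3 * β)
  hb_small : ∀ a : ℝ, 0 < a → ∀ᶠ β in atTop, b β ^ 2 ≤ a * bareLambda ((L : ℝ) ^ 3 * β)
  -- the analytic bricks
  hN : ∀ᶠ β in atTop, ∀ u ∈ 𝒰 β, |fibreMass L (softWeight (χ β)) (Ω β) u - γ β| ≤ κ β * γ β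
  hT : ∀ᶠ β in atTop, ∀ φ : GaugeConfig 3 1 SU2 → ℝ, Measurable φ → (∃ C : ℝ, ∀ u, |φ u| ≤ C) →
    (∀ (g : Site 3 1 → SU2) (u : GaugeConfig 3 1 SU2), φ (gaugeTransform g u) = φ u) → (∀ u, φ u ≠ 0 → u ∈ 𝒰 β) →
    |tubeForm β (boFun L φ (Ω β)) - σ β * γ β * qform su2Rep ((L : ℝ) ^ 3 * β) φ φ| ≤
      κ β * (σ β * γ β) * (qform su2Rep ((L : ℝ) ^ 3 * β) φ φ + levelValue su2Rep 1 ((L : ℝ) ^ 3 * β) 0 * l2 φ φ)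
  hST : ∀ᶠ β in atTop, ∀ v : GaugeConfig 3 L SU2 → ℝ, Measurable v → (∃ C : ℝ, ∀ U, |v U| ≤ C) → (∀ U, v U ≠ 0 → χ β U ≠ 0) →
    (∀ u, fibreInner L (softWeight (χ β)) (Ω β) v u = 0) →
    tubeForm β v ≤ (1 - θ₀) * (σ β * levelValue su2Rep 1 ((L : ℝ) ^ 3 * β) 0) * tubeNormSq (softWeight (χ β)) v
  hOD : ∀ᶠ β in atTop, ∀ (φ : GaugeConfig 3 1 SU2 → ℝ) (v : GaugeConfig 3 L SU2 → ℝ), Measurable φ → (∃ C : ℝ, ∀ u, |φ u| ≤ C) → (∀ u, φ u ≠ 0 → u ∈ 𝒰 β) →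
    Measurable v → (∃ C : ℝ, ∀ U, |v U| ≤ C) → (∀ U, v U ≠ 0 → χ β U ≠ 0) → (∀ u, fibreInner L (softWeight (χ β)) (Ω β) v u = 0) →
    |tubeCross β (boFun L φ (Ω β)) v| ≤ b β * (σ β * levelValue su2Rep 1 ((L : ℝ) ^ 3 * β) 0) *
        Real.sqrt (tubeNormSq (softWeight (χ β)) (boFun L φ (Ω β))) * Real.sqrt (tubeNormSq (softWeight (χ β)) v) ∧
    |tubeCross β v (boFun L φ (Ω β))| ≤ b β * (σ β * levelValue su2Rep 1 ((L : ℝ) ^ 3 * β) 0) *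
        Real.sqrt (tubeNormSq (softWeight (χ β)) (boFun L φ (Ω β))) * Real.sqrt (tubeNormSq (softWeight (χ β)) v)

/-! ## §2 The arithmetic of the assembly -/

variable {L}

/-- ★ **SLOW endgame arithmetic**: `y ∈ [0,1]`, `0 ≤ κ ≤ y/48`, `μ₀/2 ≤ μ_k`, `μ₀ ≥ 0` ⇒ `(1+κ)e^{y/8}μ_k + κμ₀ ≤ (1−κ)e^{y/4}μ_k`. [folklore] -/
theorem arith_slow {y κ μ0 μk : ℝ} (hy0 : 0 ≤ y) (hy1 : y ≤ 1) (hκ0 : 0 ≤ κ) (hκ : κ ≤ y / 48) (hμ0 : 0 ≤ μ0) (hμk : μ0 / 2 ≤ μk) :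
    (1 + κ) * Real.exp (y / 8) * μk + κ * μ0 ≤ (1 - κ) * Real.exp (y / 4) * μk := by
  have hμk0 : 0 ≤ μk := by linarith
  -- `e^{x}(1 − x) ≤ 1` (from `1 − x ≤ e^{−x}`), at `x = y/4, y/8`
  have hexp : ∀ x : ℝ, x < 1 → Real.exp x * (1 - x) ≤ 1 := fun x hx => by
    have h := Real.add_one_le_exp (-x)
    have h2 : Real.exp x * (1 - x) ≤ Real.exp x * Real.exp (-x) := mul_le_mul_of_nonneg_left (by linarith) (Real.exp_pos x).le
    rwa [← Real.exp_add, add_neg_cancel, Real.exp_zero] at h2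
  have hA : Real.exp (y / 4) ≤ 4 / 3 := by
    have h := hexp (y / 4) (by linarith); have := Real.exp_pos (y / 4); nlinarith
  have hB : Real.exp (y / 8) ≤ 8 / 7 := by
    have h := hexp (y / 8) (by linarith); have := Real.exp_pos (y / 8); nlinarith
  have hB1 : 1 ≤ Real.exp (y / 8) := Real.one_le_exp (by positivity)
  -- `e^{y/4} − e^{y/8} ≥ y/8`
  have hgap : y / 8 ≤ Real.exp (y / 4) - Real.exp (y / 8) := by
    have h1 : Real.exp (y / 4) = Real.exp (y / 8) * Real.exp (y / 8) := by rw [← Real.exp_add]; ring_nf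
    have h2 : y / 8 + 1 ≤ Real.exp (y / 8) := Real.add_one_le_exp _
    rw [h1]; nlinarith
  -- `κ (e^{y/4} + e^{y/8} + 2) ≤ y/8`
  have hκb : κ * (Real.exp (y / 4) + Real.exp (y / 8) + 2) ≤ y / 8 := by
    have : Real.exp (y / 4) + Real.exp (y / 8) + 2 ≤ 6 := by linarith
    nlinarith
  nlinarith [mul_nonneg hκ0 hμk0, mul_le_mul_of_nonneg_right hκb hμk0, mul_le_mul_of_nonneg_right hgap hμk0, mul_nonneg hκ0 hμ0]

/-- ★ **FLOOR endgame arithmetic**: `y ∈ [0,1]`, `0 ≤ κ ≤ y/48` ⇒ `e^{−y/4}(1 + y/64)(1+κ) ≤ (1−κ)e^{−y/16} − κ`. [folklore] -/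
theorem arith_floor {y κ : ℝ} (hy0 : 0 ≤ y) (hy1 : y ≤ 1) (hκ0 : 0 ≤ κ) (hκ : κ ≤ y / 48) :
    Real.exp (-(y / 4)) * ((1 + y / 64) * (1 + κ)) ≤ (1 - κ) * Real.exp (-(y / 16)) - κ := by
  set A : ℝ := Real.exp (-(y / 4)) with hAdef
  set B : ℝ := Real.exp (-(y / 16)) with hBdef
  have hA1 : A ≤ 1 := by rw [hAdef]; exact Real.exp_le_one_iff.mpr (by linarith)
  have hB1 : B ≤ 1 := by rw [hBdef]; exact Real.exp_le_one_iff.mpr (by linarith)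
  have hA0 : 0 ≤ A := (Real.exp_pos _).le
  have hA34 : 3 / 4 ≤ A := by rw [hAdef]; have := Real.add_one_le_exp (-(y / 4)); linarith
  -- `B − A = A (e^{3y/16} − 1) ≥ A · 3y/16`
  have hBA : A * (3 * y / 16) ≤ B - A := by
    have h1 : B = A * Real.exp (3 * y / 16) := by rw [hAdef, hBdef, ← Real.exp_add]; ring_nf
    have h2 : 3 * y / 16 + 1 ≤ Real.exp (3 * y / 16) := Real.add_one_le_exp _
    rw [h1]; nlinarith
  -- main: `B − A − A y/64 − κ (B + 1 + A(1 + y/64)) ≥ 0`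
  have hk : κ * (B + 1 + A * (1 + y / 64)) ≤ y / 48 * (2 + 65 / 64) := by
    have : B + 1 + A * (1 + y / 64) ≤ 2 + 65 / 64 := by nlinarith
    have h0 : 0 ≤ B + 1 + A * (1 + y / 64) := by have := (Real.exp_pos (-(y / 16))).le; rw [← hBdef] at this; positivity
    nlinarith
  nlinarith [hBA, hk, hA34, mul_nonneg hA0 hy0]

end Summit.QuantumFields.YangMills.Theorems.FemtoTransferGap.TwoLattice.ConstTube

end
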